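import Literature.AlgebraicGeometry.Motives.ProjectiveBundleOfQuotientSmoothProjective
import Literature.AlgebraicGeometry.Motives.GrassmannianOneGeometricallyIrreducible
import Literature.AlgebraicGeometry.HodgeTheory.ProjectiveBundleTautologicalQuotientOfGloballyGenerated
import Literature.AlgebraicGeometry.HodgeTheory.SplittingPrincipleBettiOfFlagBundle
import HarnessLib

/-!
# PROOF of the named facts `ProjectiveBundleOfGloballyGeneratedQuotient`, `ProjectiveBundleTautologicalQuotient`, `FlagBundleSplitting`, `SplittingPrincipleBetti`

Topic `AlgebraicGeometry/HodgeTheory`; namespace `Literature.AlgebraicGeometry.HodgeTheory`. THEOREMS ONLY (no definition, no instance,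
no notation, no named fact, no `sorry`): the `_holds` discharges.

The chain (all tree files ★):
* `Motives/ProjectiveBundleOfQuotient*` — the incidence model `P(G) = V(u_φ) ↪ X × Gr₁(ℤ^J)` of an epimorphism `𝒪^J ↠ G`
  ([GortzWedhorn2020, (13.8), (8.4)]; [Hartshorne1977, II §7]): projective over `X`, tautological line quotient and rank-`r` kernel,
  local triviality `P(G)|_U ≅ U × Gr₁(ℤ^{r+1})` (representability of `U`-points), hence smooth of relative dimension `r` and —
  by `Motives/GrassmannianOneGeometricallyIrreducible` (`Gr₁ → Spec ℤ` geometrically irreducible) — geometrically irreducible;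
  so `P(G)` is a smooth projective `(n + r)`-fold: **`projectiveBundleOfGloballyGeneratedQuotient_holds`**;
* `HodgeTheory/ProjectiveBundleTautologicalQuotientReduction` (constant rank, Serre's theorem A, `P(F) = P(F ⊗ L)`):
  **`projectiveBundleTautologicalQuotient_holds`** ([Hartshorne1977, II §7 Prop. 7.11–7.12]);
* `HodgeTheory/FlagBundleSplittingOfProjectiveBundle` (the tower): **`flagBundleSplitting_holds`** ([Fulton1998, §3.2]);
* `HodgeTheory/SplittingPrincipleBettiOfFlagBundle` (+ Leray–Hirsch injectivity, a named fact INSIDE `SplittingPrincipleBetti`'s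
  reduction? — no: ★ `splittingPrincipleBetti_of_flagBundleSplitting` is proved in the tree): **`splittingPrincipleBetti_holds`**.

## References
* [Hartshorne1977] R. Hartshorne, *Algebraic Geometry* (1977), II §7 Prop. 7.10–7.12; III Prop. 10.1.
* [GortzWedhorn2020] U. Görtz, T. Wedhorn, *Algebraic Geometry I*, 2nd ed. (2020), (13.8), (8.4), Cor. 8.15.
* [Fulton1998] W. Fulton, *Intersection Theory*, 2nd ed. (1998), §3.2, B.5.5.
-/

noncomputable section

open CategoryTheory CategoryTheory.Limits AlgebraicGeometry
open Literature.AlgebraicGeometry.Motives Literature.AlgebraicGeometry.Motives.Grassmannian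

namespace Literature.AlgebraicGeometry.HodgeTheory

/-- **`ProjectiveBundleOfGloballyGeneratedQuotient` HOLDS**: for a smooth projective complex `n`-fold `X`, an epimorphism
`𝒪_X^J ↠ G` (`J` finite) onto a bundle of rank `r + 1`, the incidence scheme `P(G) → X` is a smooth projective `(n + r)`-fold,
surjective over `X`, carrying the tautological sequence `0 → K → p^*G → L → 0` (`K` of rank `r`, `L` a line bundle).
[cite: Hartshorne1977, II §7 Prop. 7.10–7.12] [cite: GortzWedhorn2020, (13.8) and Cor. 8.15] -/
theorem projectiveBundleOfGloballyGeneratedQuotient_holds : ProjectiveBundleOfGloballyGeneratedQuotient :=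
  ProjBundle.projectiveBundleOfGloballyGeneratedQuotient_of_geometricallyIrreducible_of_nonempty
    fun J' _ _ _ _ => geometricallyIrreducible_terminal_from_one (J' →₀ ℤ) (Finsupp.basisSingleOne (R := ℤ) (ι := J'))

/-- **`ProjectiveBundleTautologicalQuotient` HOLDS** (one level of Grothendieck's `P(ℰ)` with its tautological quotient, for every
bundle of rank `≤ r + 1` on a smooth projective complex variety). [cite: Hartshorne1977, II §7 Prop. 7.11–7.12] -/
theorem projectiveBundleTautologicalQuotient_holds : ProjectiveBundleTautologicalQuotient :=
  projectiveBundleTautologicalQuotient_of_globallyGenerated projectiveBundleOfGloballyGeneratedQuotient_holds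

/-- **`FlagBundleSplitting` HOLDS** (Grothendieck's splitting construction: a smooth projective `Y → X`, surjective, on which the
pulled-back bundle has a full flag with line-bundle graded pieces). [cite: Fulton1998, §3.2] [cite: Hartshorne1977, II §7 Prop. 7.11] -/
theorem flagBundleSplitting_holds : FlagBundleSplitting :=
  flagBundleSplitting_of_globallyGenerated projectiveBundleOfGloballyGeneratedQuotient_holds

/-- **`SplittingPrincipleBetti` HOLDS** (★ `splittingPrincipleBetti_of_flagBundleSplitting`). [cite: Fulton1998, §3.2]
[cite: Hartshorne1977, II §7 Prop. 7.11] -/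
theorem splittingPrincipleBetti_holds : SplittingPrincipleBetti :=
  splittingPrincipleBetti_of_flagBundleSplitting flagBundleSplitting_holds

end Literature.AlgebraicGeometry.HodgeTheory

end
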